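import Mathlib
import HarnessLib
import Literature.AlgebraicGeometry.Resolution.BlowupStalkCharts
import Literature.AlgebraicGeometry.Resolution.BlowupChartQuasiRegular

/-!
# The augmentation ideal of a lifted action at a point of a blow-up: base part plus chart-generator moves

(crux stmt-ResolutionOfSingularities-15640 `WildQuotients.WildQuotientResolution`, line `Sketch`,
sector `|G| = p`; rung V3 of `L/w45c/CHAIN.md` v4 (tower bookkeeping for centres that are NOT
generated by invariants); [OURS · L1 W4.5c] — NOT a statement of any manuscript; replaces the role
of no printed item.)

Stalk-level twin of `TerminalBlowup.exists_span_stalkAug_eq` (p468243) WITHOUT the invariance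
hypotheses. Let `π : V → X` be a blow-up along the ideal sheaf `J` (`IsBlowup π J`), `α : V → V`,
`β : X → X` with `α ≫ π = π ≫ β`, `v ∈ V` fixed by `α` (so `s = π v` is fixed by `β`), and
`c : Fin n → 𝒪_{X,s}` generators of the stalk `J_s`. Write `a = stalkSpecializes ≫ α^♯_v`,
`b = stalkSpecializes ≫ β^♯_s` for the stalk actions. Then (`exists_reesChart_span_stalkAug_eq_sup`)
for some chart index `j`, `𝒪_{V,v}` is the localisation at a prime `𝔴` of the Rees chart
`B_j = 𝒪_{X,s}[J_s/c_j]` through `χ : B_j → 𝒪_{V,v}` with `χ ∘ (𝒪_{X,s} → B_j) = π^♯_v`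
(`IsBlowup.exists_reesChart_stalk`), the stalk actions are intertwined
(`a (π^♯_v r) = π^♯_v (b r)`), and
`⟨a y - y : y ∈ 𝒪_{V,v}⟩ = ⟨b r - r : r ∈ 𝒪_{X,s}⟩·𝒪_{V,v} ⊔ ⟨a (χ e_l) - χ e_l : l ≠ j⟩`
where `e_l = c_l/c_j` are the chart generators — «augmentation upstairs = augmentation downstairs
+ the moves of the chart generators». The moves are then computed inside `B_j` by
`TerminalBlowup.stalkAction_chartGen_of_chart` (p472666) and its unit-twisted variant, and for the
`J₃` tower the resulting three-generator ideals are simplified by `JordanThree.step*_span_eq`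
(`…JordanThreeChartAlgebra`). Proof of `⊆`: the ring maps `𝒪_{V,v} → 𝒪_{V,v}/K`, `y ↦ [a y]` and
`y ↦ [y]`, agree on `π^♯_v(𝒪_{X,s})` and on the `χ e_l`, hence on `χ(B_j)`
(`eval₂Hom_chartGen_surjective`) and on the localisation; `⊇`: `π^♯_v (b r - r) = a (π^♯_v r) - π^♯_v r`.
-/

-- single-problem summit: the doubled namespace component `ResolutionOfSingularities` is forced
set_option linter.dupNamespace false

noncomputable section

open CategoryTheory AlgebraicGeometry TopologicalSpace IsLocalRing
open Literature.AlgebraicGeometry.Resolution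

namespace Summit.ResolutionOfSingularities.ResolutionOfSingularities.Theorems.WildQuotientResolution.TerminalBlowup

universe u

set_option maxHeartbeats 400000 in
/-- **Augmentation ideal of a lifted action at a fixed point of a blow-up = base augmentation
ideal + moves of the chart generators** (Rees-chart presentation of the stalk included, so that
the moves can be computed by `stalkAction_chartGen_of_chart` / its twisted variant). See the module
docstring. [cite: StacksProject, Tag 0804] [folklore] -/
theorem exists_reesChart_span_stalkAug_eq_sup {V X : Scheme.{u}} {π : V ⟶ X}
    {J : X.IdealSheafData} (hπ : IsBlowup π J) {α : V ⟶ V} {β : X ⟶ X}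
    (hequiv : α ≫ π = π ≫ β) (v : V) (hv : α.base v = v) {n : ℕ}
    (c : Fin n → X.presheaf.stalk (π.base v))
    (hc : Ideal.span (Set.range c) = stalkIdeal J (π.base v)) :
    ∃ (hs : β.base (π.base v) = π.base v) (j : Fin n) (𝔴 : PrimeSpectrum (chartRing c j))
      (χ : chartRing c j →+* V.presheaf.stalk v),
      (∀ r, χ (chartBase c j r) = (π.stalkMap v).hom r) ∧
      @IsLocalization.AtPrime _ _ (V.presheaf.stalk v) _ χ.toAlgebra 𝔴.asIdeal _ ∧
      (∀ r, (V.presheaf.stalkSpecializes (specializes_of_eq hv) ≫ α.stalkMap v).hom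
          ((π.stalkMap v).hom r) =
        (π.stalkMap v).hom
          ((X.presheaf.stalkSpecializes (specializes_of_eq hs) ≫ β.stalkMap (π.base v)).hom r)) ∧
      Ideal.span (Set.range fun y =>
          (V.presheaf.stalkSpecializes (specializes_of_eq hv) ≫ α.stalkMap v).hom y - y) =
        (Ideal.span (Set.range fun r =>
          (X.presheaf.stalkSpecializes (specializes_of_eq hs) ≫ β.stalkMap (π.base v)).hom r -
            r)).map (π.stalkMap v).hom ⊔
        Ideal.span (Set.range fun l : {l : Fin n // l ≠ j} =>
          (V.presheaf.stalkSpecializes (specializes_of_eq hv) ≫ α.stalkMap v).hom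
            (χ (chartGen c j l.1)) - χ (chartGen c j l.1)) := by
  classical
  -- `β` fixes `s = π v`
  have hs : β.base (π.base v) = π.base v := by
    have h := congrArg (fun f : V ⟶ X => f.base v) hequiv
    simp only [Scheme.Hom.comp_base, TopCat.coe_comp, Function.comp_apply] at h
    rw [hv] at h
    exact h.symm
  set aH := V.presheaf.stalkSpecializes (specializes_of_eq hv) ≫ α.stalkMap v with haH
  set bH := X.presheaf.stalkSpecializes (specializes_of_eq hs) ≫ β.stalkMap (π.base v) with hbH
  -- the stalk actions are intertwined by `π^♯_v`: cancel the monomorphism `Spec 𝒪_{X,s} → X`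
  have hkeya : Spec.map aH ≫ V.fromSpecStalk v = V.fromSpecStalk v ≫ α := by
    rw [haH, Spec.map_comp, Category.assoc, Scheme.SpecMap_stalkSpecializes_fromSpecStalk,
      Scheme.SpecMap_stalkMap_fromSpecStalk]
  have hkeyb : Spec.map bH ≫ X.fromSpecStalk (π.base v) = X.fromSpecStalk (π.base v) ≫ β := by
    rw [hbH, Spec.map_comp, Category.assoc, Scheme.SpecMap_stalkSpecializes_fromSpecStalk,
      Scheme.SpecMap_stalkMap_fromSpecStalk]
  have hcompat : bH ≫ π.stalkMap v = π.stalkMap v ≫ aH := by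
    apply Spec.map_injective
    rw [← cancel_mono (X.fromSpecStalk (π.base v))]
    simp only [Spec.map_comp, Category.assoc, hkeyb, Scheme.SpecMap_stalkMap_fromSpecStalk,
      Scheme.SpecMap_stalkMap_fromSpecStalk_assoc]
    rw [reassoc_of% hkeya, hequiv]
  have hab : ∀ r, aH.hom ((π.stalkMap v).hom r) = (π.stalkMap v).hom (bH.hom r) := fun r => by
    rw [← CommRingCat.comp_apply, ← CommRingCat.comp_apply, hcompat]
  -- `𝒪_{V,v}` is a localisation of a Rees chart of `Bl_{J_s} Spec 𝒪_{X,s}`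
  obtain ⟨j, 𝔴, χ, hχ, hloc, -⟩ := hπ.exists_reesChart_stalk v c hc
  refine ⟨hs, j, 𝔴, χ, hχ, hloc, hab, ?_⟩
  letI := χ.toAlgebra
  haveI : IsLocalization.AtPrime (V.presheaf.stalk v) 𝔴.asIdeal := hloc
  have hχalg : ∀ z, algebraMap (chartRing c j) (V.presheaf.stalk v) z = χ z := fun z => by
    rw [RingHom.algebraMap_toAlgebra]
  set K := (Ideal.span (Set.range fun r => bH.hom r - r)).map (π.stalkMap v).hom ⊔
    Ideal.span (Set.range fun l : {l : Fin n // l ≠ j} =>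
      aH.hom (χ (chartGen c j l.1)) - χ (chartGen c j l.1)) with hK
  apply le_antisymm
  · -- `⊆`: the ring maps `𝒪_{V,v} → 𝒪_{V,v}/K`, `y ↦ [a y]` and `y ↦ [y]`, agree
    let mk : V.presheaf.stalk v →+* (V.presheaf.stalk v) ⧸ K := Ideal.Quotient.mk K
    have hagree : mk.comp aH.hom = mk := by
      apply IsLocalization.ringHom_ext 𝔴.asIdeal.primeCompl (S := V.presheaf.stalk v)
      have key : ((mk.comp aH.hom).comp (algebraMap (chartRing c j) (V.presheaf.stalk v))).comp
            (MvPolynomial.eval₂Hom (chartBase c j)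
              (fun l : {l : Fin n // l ≠ j} => chartGen c j l.1)) =
          ((mk.comp (algebraMap (chartRing c j) (V.presheaf.stalk v)))).comp
            (MvPolynomial.eval₂Hom (chartBase c j)
              (fun l : {l : Fin n // l ≠ j} => chartGen c j l.1)) := by
        refine MvPolynomial.ringHom_ext (fun r => ?_) (fun l => ?_)
        · -- constants: `a (π♯ r) - π♯ r = π♯ (b r - r) ∈ K`
          simp only [RingHom.comp_apply, MvPolynomial.eval₂Hom_C]
          rw [hχalg, hχ, hab, Ideal.Quotient.eq]
          refine Ideal.mem_sup_left ?_
          have e : (π.stalkMap v).hom (bH.hom r) - (π.stalkMap v).hom r =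
              (π.stalkMap v).hom (bH.hom r - r) := by rw [map_sub]
          rw [e]
          exact Ideal.mem_map_of_mem _ (Ideal.subset_span ⟨r, rfl⟩)
        · -- chart generators: their moves are in `K` by definition
          simp only [RingHom.comp_apply, MvPolynomial.eval₂Hom_X']
          rw [hχalg, Ideal.Quotient.eq]
          exact Ideal.mem_sup_right (Ideal.subset_span ⟨l, rfl⟩)
      exact RingHom.ext fun z => by
        obtain ⟨P, rfl⟩ := eval₂Hom_chartGen_surjective c j z
        exact RingHom.congr_fun key P
    refine Ideal.span_le.mpr ?_
    rintro _ ⟨y, rfl⟩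
    have hy : mk (aH.hom y) = mk y := by rw [← RingHom.comp_apply, hagree]
    exact Ideal.Quotient.eq.mp hy
  · -- `⊇`
    rw [hK]
    refine sup_le ?_ ?_
    · rw [Ideal.map_span]
      refine Ideal.span_mono ?_
      rintro _ ⟨_, ⟨r, rfl⟩, rfl⟩
      refine ⟨(π.stalkMap v).hom r, ?_⟩
      change aH.hom ((π.stalkMap v).hom r) - (π.stalkMap v).hom r = (π.stalkMap v).hom (bH.hom r - r)
      rw [map_sub, hab]
    · refine Ideal.span_mono ?_
      rintro _ ⟨l, rfl⟩
      exact ⟨χ (chartGen c j l.1), rfl⟩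

end Summit.ResolutionOfSingularities.ResolutionOfSingularities.Theorems.WildQuotientResolution.TerminalBlowup

end
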